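import Literature.AnabelianGeometry.SemiGraphs.Prop36HypothesesWitnessAffChart
import Literature.AnabelianGeometry.SemiGraphs.TemperedLevelDictionaryCov
import Literature.AnabelianGeometry.SemiGraphs.TemperedCompactInVerticialOfLevelData
import Literature.AnabelianGeometry.SemiGraphs.TemperedVerticialDistinctSameVertex

/-!
# The repaired level dictionary `CovLevelDictionary` is instantiable — with all four obligations — at the Prop. 3.6 / Thm. 3.7 witness

Mochizuki, *Semi-graphs of anabelioids*, Publ. RIMS **42** (2006) [MochizukiSemiAnbd2006], Thm. 3.7
(iii) pp. 264–265 (kurims pp. 40–41) and its proof with the author's *Comments* (2020) (6); Rmk.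
2.2.1 p. 248 (kurims p. 24); Def. 2.2 (i) p. 247 (kurims p. 23).

KERNEL CERTIFICATE (cell abc-iut, layer L3, row WIT-1c; seat abc-iut-w5-d212; ruling α5-1/α8-2 of
abc-iut-L3-lead).  abc-iut-L3-t11's `LevelDictionary` (kernels of the actions on the level GRAPHS,
asked to meet in `1`) is uninstantiable at the edgeless one-vertex witness `affWitness p`
(negative knowledge O-LD-1; kernel certificate `LevelDictionary.eq_one_of_forall_levelAct`,
abc-iut-L3-t10).  This file shows that abc-iut-L3-t10's REPAIRED interface
`CovLevelDictionary` (`TemperedLevelDictionaryCov.lean`: an antitone family `M_j` of open normal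
subgroups of the compact overgroup `Q` meeting in `1` — print's COVERING kernels) IS instantiable
at that very witness, over the explicit chart `affChart p` (`π₁^temp = Aff(ℤ_p)`), AND that all four
single-level obligations (DV) (DB) (DI) (DN) — in their UNPRIMED `∀γ`-form — hold for the instance:
levels and trees are the point graph, all actions are trivial, `Q := Aff(ℤ_p)`, `ι_Q = ψ_v = id`,
`M_j := Γ_j` (the congruence subgroups: open, normal, antitone, `⋂_j Γ_j = 1`); (DV) says the
stabiliser of the unique level vertex — everything — is `ψ_v(Π_v)·Γ_j = Aff(ℤ_p)`; (DB) (DI) (DN)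
are vacuous (no branches).  Hence the glue `CovLevelDictionary.toFiniteLevelData` is inhabited
(`affFiniteLevelData`), and the cell's Thm. 3.7 (iii) assembly `FiniteLevelData.compactInVerticial`
RUNS END-TO-END on a concrete object: both conjuncts of `CompactInVerticial` at
`(affWitness p, affChart p)`, unconditionally (`compactInVerticial_affWitness_affChart`).
So the repaired interface together with its four obligations is CONSISTENT; this complements
abc-iut-L3-t11's `D₄` example (the `∀γ`-forms are not dischargeable at levels with extra
normaliser), which concerns other instances.  A witness certifies consistency / non-vacuity only;
no statement of the paper is touched, strengthened or assumed.  Nothing here takes a side on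
[IUTchIII] Cor. 3.12.
-/

noncomputable section

namespace Literature.AnabelianGeometry.SemiGraphs

namespace ProfiniteSemiGraph

open CategoryTheory Topology Literature.GroupTheory.SpecificGroups

variable {p : ℕ} [Fact p.Prime]

/-! ### The point graph is a tree; trivial actions -/

/-- The barycentric subdivision of the point graph has exactly one node.
[cite: MochizukiSemiAnbd2006, §1 pp.11-12] -/
private theorem subsingleton_node_ptSemiGraph : Subsingleton ptSemiGraph.Node :=
  ⟨by rintro (a | a | a) (b | b | b) <;> first | rfl | exact a.elim | exact b.elim⟩

/-- The point graph (one vertex, no edges) is a tree. [cite: MochizukiSemiAnbd2006, §1 p.13] -/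
theorem isTree_ptSemiGraph : ptSemiGraph.IsTree :=
  haveI : Subsingleton ptSemiGraph.Node := subsingleton_node_ptSemiGraph
  haveI : Nonempty ptSemiGraph.Node := ⟨Sum.inl PUnit.unit⟩
  ⟨SimpleGraph.IsTree.of_subsingleton⟩

/-- The identity of the point graph is an immersion. [cite: MochizukiSemiAnbd2006, §1 pp.13-14] -/
theorem isImmersion_id_ptSemiGraph : SemiGraph.IsImmersion (𝟙 ptSemiGraph) :=
  fun _ a => a.1.elim

/-- The congruence subgroups are antitone: `Γ_j ≤ Γ_i` for `i ≤ j`. [cite: MochizukiSemiAnbd2006, §0 p.6] -/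
theorem level_antitone {i j : ℕ} (h : i ≤ j) : PadicAffine.level p j ≤ PadicAffine.level p i := by
  intro x hx
  have hI : PadicAffine.I p j ≤ PadicAffine.I p i :=
    Ideal.span_singleton_le_span_singleton.mpr (pow_dvd_pow _ h)
  exact ⟨hI hx.1, hI hx.2⟩

/-- The congruence subgroups meet in `1` (they form a basis of neighbourhoods of `1` in a Hausdorff
group). [cite: MochizukiSemiAnbd2006, §0 p.6] -/
theorem eq_one_of_forall_mem_level (q : PadicAffine p) (hq : ∀ n, q ∈ PadicAffine.level p n) :
    q = 1 := by
  by_contra hne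
  obtain ⟨n, -, hsub⟩ := PadicAffine.exists_level_subset (V := {x : PadicAffine p | x ≠ q})
    isOpen_ne (Ne.symm hne)
  exact hsub (hq n) rfl

/-! ### The dictionary -/

variable (p) in
/-- **The covering level dictionary of the witness** over the explicit chart `affChart p`
(`π₁^temp = Aff(ℤ_p)`): index set `ℕ`; trees `𝒢_{∞,j}` and levels `𝔾_j` all equal to the point
graph (the underlying semi-graph of every connected finite étale covering of the one-vertex
edgeless `𝒢`, which is its own universal graph-covering); all actions trivial; `Q := Aff(ℤ_p)`
with `ι_Q = id` (here `π₁^temp` is already profinite); covering kernels `M_j := Γ_j` (the kernel of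
`Aff(ℤ_p) → Gal(𝒢_j/𝒢) = Aff(ℤ_p)/Γ_j` for the Galois covering with fibre `Aff(ℤ_p)/Γ_j`);
reference embedding `ψ_v = id`; no branch representatives to choose.
[cite: MochizukiSemiAnbd2006, Rmk. 2.2.1 p.24] -/
def affCovLevelDictionary : CovLevelDictionary.{0} (affWitness p) (affChart p) where
  J := ℕ
  tree := fun _ => ptSemiGraph
  isTree := fun _ => isTree_ptSemiGraph
  vertex := fun _ => PUnit.unit
  proj := fun _ => 𝟙 ptSemiGraph
  act := fun _ => 1
  isOpen_ker := fun _ => by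
    rw [MonoidHom.ker_one]
    exact isOpen_univ
  act_over := fun _ _ => rfl
  trans := fun _ _ _ => 𝟙 ptSemiGraph
  trans_id := fun _ => rfl
  trans_comp := fun _ _ _ _ _ => rfl
  trans_over := fun _ _ _ => rfl
  trans_act := fun _ _ _ _ => rfl
  fix := fun _ _ _ => ⟨fun _ => PUnit.unit, fun _ _ _ => rfl, fun _ _ _ => rfl⟩
  stab := fun _ _ => ⟨PUnit.unit, ⊤, top_mem_verticialSubgroups_affChart _, fun _ _ => trivial⟩
  edge := fun j₁ ε _ => PEmpty.elim (ε ⟨j₁, le_refl j₁⟩)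
  level := fun _ => ptSemiGraph
  finiteVertex := fun _ => inferInstanceAs (Finite PUnit)
  finiteBranch := fun _ => inferInstanceAs (Finite PEmpty)
  quot := fun _ => 𝟙 ptSemiGraph
  quot_isImmersion := fun _ => isImmersion_id_ptSemiGraph
  levelAct := fun _ => 1
  act_quot := fun _ _ => rfl
  levelTrans := fun _ _ _ => 𝟙 ptSemiGraph
  levelTrans_id := fun _ => rfl
  levelTrans_comp := fun _ _ _ _ _ => rfl
  levelTrans_act := fun _ _ _ _ => rfl
  trans_quot := fun _ _ _ => rfl
  levelProj := fun _ => 𝟙 ptSemiGraph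
  levelProj_trans := fun _ _ _ => rfl
  Q := PadicAffine p
  ιQ := MonoidHom.id (PadicAffine p)
  ιQ_injective := fun _ _ h => h
  qAct := fun _ => 1
  qAct_ιQ := fun _ _ => rfl
  M := PadicAffine.level p
  M_normal := PadicAffine.level_normal
  isOpen_M := PadicAffine.isOpen_level
  M_anti := fun _ _ h => level_antitone h
  M_trivial := eq_one_of_forall_mem_level
  qAct_trans := fun _ _ _ _ _ => rfl
  ψ := fun _ => MonoidHom.id (PadicAffine p)
  ψ_injective := fun _ _ _ h => h
  ψ_continuous := fun _ => continuous_id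
  rep := fun _ _ _ _ β => PEmpty.elim β

/-- The index set of the dictionary is `ℕ` (definitionally). [cite: MochizukiSemiAnbd2006, Rmk. 2.2.1 p.24] -/
theorem affCovLevelDictionary_J : (affCovLevelDictionary p).J = ℕ := rfl

/-- The covering kernels of the dictionary are the congruence subgroups (definitionally).
[cite: MochizukiSemiAnbd2006, Rmk. 2.2.1 p.24] -/
theorem affCovLevelDictionary_M (j : ℕ) :
    (affCovLevelDictionary p).M j = PadicAffine.level p j := rfl

/-! ### The four obligations hold -/

/-- **(DV) holds** for the witness dictionary: the stabiliser of the (unique) level vertex is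
everything, and `γ·ψ_v(Π_v)·γ⁻¹·Γ_j = Aff(ℤ_p)` already for `γ = 1`.
[cite: MochizukiSemiAnbd2006, Rmk. 2.2.1 p.24] -/
theorem affCovLevelDictionary_DV : (affCovLevelDictionary p).DV := by
  intro j w v _
  refine ⟨1, fun q => ⟨fun _ => ?_, fun _ => rfl⟩⟩
  refine Subgroup.mem_sup_left ?_
  refine ⟨q, ?_, ?_⟩
  · exact ⟨q, rfl⟩
  · simp

/-- **(DB) holds** for the witness dictionary (vacuously: the levels have no branches).
[cite: MochizukiSemiAnbd2006, Rmk. 2.2.1 p.24] -/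
theorem affCovLevelDictionary_DB : (affCovLevelDictionary p).DB :=
  fun _ _ _ _ _ _ β => PEmpty.elim β

/-- **(DI) holds** for the witness dictionary (vacuously: the levels have no branches).
[cite: MochizukiSemiAnbd2006, Def. 2.2(i) p.23] -/
theorem affCovLevelDictionary_DI : (affCovLevelDictionary p).DI :=
  fun _ _ _ _ _ _ β => PEmpty.elim β

/-- **(DN) holds** for the witness dictionary (vacuously: the levels have no branches).
[cite: MochizukiSemiAnbd2006, Def. 2.2(i) p.23] -/
theorem affCovLevelDictionary_DN : (affCovLevelDictionary p).DN :=
  fun _ _ _ _ _ _ _ _ _ β => PEmpty.elim β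

/-! ### Consequences: finite-level data and Thm. 3.7 (iii) at the witness, through the cell's assembly -/

variable (p) in
/-- **The glue is inhabited**: finite-level data of the explicit chart of the witness, obtained from
the dictionary through `CovLevelDictionary.toFiniteLevelData` and the four obligations.
[cite: MochizukiSemiAnbd2006, Thm 3.7(iii) p.41] -/
def affFiniteLevelData : FiniteLevelData.{0} (affWitness p) (affChart p) :=
  (affCovLevelDictionary p).toFiniteLevelData affCovLevelDictionary_DV affCovLevelDictionary_DB
    affCovLevelDictionary_DI affCovLevelDictionary_DN

/-- Non-vacuity of the producer contract of the Thm. 3.7 (iii) route: some `𝒢` satisfying the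
hypotheses of Thm. 3.7 has a chart with finite-level data AND a covering level dictionary
satisfying (DV) (DB) (DI) (DN). [cite: MochizukiSemiAnbd2006, Thm 3.7(iii) p.41] -/
theorem exists_covLevelDictionary_obligations :
    ∃ (𝒢 : ProfiniteSemiGraph.{0}) (_ : 𝒢.Thm37Hypotheses) (c : TemperedPiChart 𝒢)
      (X : CovLevelDictionary.{0} 𝒢 c), X.DV ∧ X.DB ∧ X.DI ∧ X.DN :=
  ⟨@affWitness 2 ⟨Nat.prime_two⟩, @affWitness_thm37Hypotheses 2 ⟨Nat.prime_two⟩,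
    @affChart 2 ⟨Nat.prime_two⟩, @affCovLevelDictionary 2 ⟨Nat.prime_two⟩,
    @affCovLevelDictionary_DV 2 ⟨Nat.prime_two⟩, @affCovLevelDictionary_DB 2 ⟨Nat.prime_two⟩,
    @affCovLevelDictionary_DI 2 ⟨Nat.prime_two⟩, @affCovLevelDictionary_DN 2 ⟨Nat.prime_two⟩⟩

/-- **Thm. 3.7 (iii) at the witness, END-TO-END through the cell's assembly**: both conjuncts of
`CompactInVerticial` for `(affWitness p, affChart p)` and every compact subgroup `C`, obtained by
feeding `affFiniteLevelData` to `FiniteLevelData.compactInVerticial` (with the tree's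
`verticialDistinct_holds` and the explicit verticial subgroup `⊤`).
[cite: MochizukiSemiAnbd2006, Thm 3.7(iii) pp.40-41] -/
theorem compactInVerticial_affWitness_affChart (C : Subgroup (affChart p).G)
    (hC : IsCompact (C : Set (affChart p).G)) :
    (∃ (v : (affWitness p).graph.Vertex) (H : Subgroup (affChart p).G),
        H ∈ verticialSubgroups (affChart p) v ∧ C ≤ H) ∧
      (C ≠ ⊥ → ∀ (v₁ v₂ : (affWitness p).graph.Vertex) (H₁ H₂ : Subgroup (affChart p).G),
        H₁ ∈ verticialSubgroups (affChart p) v₁ → H₂ ∈ verticialSubgroups (affChart p) v₂ →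
        H₁ ≠ H₂ → C ≤ H₁ → C ≤ H₂ →
          (∀ (v₃ : (affWitness p).graph.Vertex) (H₃ : Subgroup (affChart p).G),
              H₃ ∈ verticialSubgroups (affChart p) v₃ → C ≤ H₃ → H₃ = H₁ ∨ H₃ = H₂) ∧
          ∃ (e : (affWitness p).graph.Edge) (L : Subgroup (affChart p).G),
            (affWitness p).graph.IsClosedEdge e ∧ L ∈ edgeLikeSubgroups (affChart p) e ∧ C ≤ L) :=
  FiniteLevelData.compactInVerticial (affFiniteLevelData p) verticialDistinct_holds
    affWitness_thm37Hypotheses (fun v => verticialSubgroups_affChart_nonempty v) C hC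

end ProfiniteSemiGraph

end Literature.AnabelianGeometry.SemiGraphs

end
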